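import Summits.PneNP.PneNP.Theorems.OneSliceSliceTargetReplica
import Summits.PneNP.PneNP.Theorems.OneSliceSliceTargetSubthreshold
import Summits.PneNP.PneNP.Theorems.OneSliceSliceTargetCliqueDensityLower
import Summits.PneNP.PneNP.Theorems.OneSliceSliceTargetPairBound

/-!
# Route OneSlice, crux `SliceTarget` (stmt-PneNP-2832), line `Sketch-ideator3-r1`: the QUARTER floor and the reduction of
# the exponents `c ≥ 2` of the crux to the size window `C(n,2) ≤ 4·size + 1`

X = `SliceTarget` = `∀ c, X(c)`, `X(c)` = "∃ k ≥ 3, δ > 0: eventually, on every central slice `j` of the critical window,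
every `δ`-accurate `{∧₂,∨₂}`-circuit for `CLIQUE_k` has more than `n^c` gates". The exponents `c ≤ 1` are settled by locality
(`Theorems/OneSliceSliceTargetTransfer.lean`, `sliceLB_of_locality`). This file proves, from the landed second-moment bounds of
the line — B1 `replica_decoupling` (Replica), B2 `stub_cliqueDensityLower` (clique density `≥ λ − λ²/2 − ε` on central slices,
`λ = 1/k!`) and B3 `stub_pairBound` (the replica pair bound `Σ_Φ #{clique ∩ Φ}²/#Φ ≤ (λ² + λ|F|/N + ε)·#slice` over the fibres
`Φ` of a read set `F`, `2|F| ≤ N = C(n,2)`):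

* `bigBlindFloor` — **the quarter floor**, every `k ≥ 3`: eventually, on every central slice, every `{∧₂,∨₂}`-circuit that is
  `λ/8`-accurate for `CLIQUE_k` has `C(n,2) ≤ 4·size + 1`. (A circuit with fewer gates reads a set `F` of `≤ 2·size + 1 ≤ N/2`
  slots; it is constant on each fibre of `F`, so by replica decoupling its error is at least
  `#{clique} − Σ_Φ #{clique ∩ Φ}²/#Φ ≥ (λ − λ²/2 − ε − λ² − λ/2 − ε)·#slice > (λ/8)·#slice` for `ε = λ/32`, as `λ ≤ 1/6 < 5/24`.)
* `sliceTargetFrom2_of_quarter` — hence X(c) for every `c ≥ 2` follows from its restriction to circuits IN the window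
  `C(n,2) ≤ 4·size + 1` (the registered stub T9 `stub_sliceHardQuarter` of the line skeleton), and conversely
  (`quarter_of_sliceTargetFrom2`, trivial): `quarter_iff_sliceTargetFrom2`.

So the content of the crux above exponent `1` is exactly: "for every `c ≥ 2` some `k` and `δ > 0` make every `{∧₂,∨₂}`-circuit with
between `C(n,2)/4` and `n^c` gates err on more than a `δ`-fraction of every central critical slice" — at `c = 2` a LINEAR-size
(in the `C(n,2)` variables) average-case lower bound on one slice, where monotone = general (Berkowitz). Lead prover-line-stmt-PneNP-2832-1,
2026-08-16 (v7 reshape of the line; the floor at `k ≥ 4` is due to lead -0).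
-/

set_option linter.dupNamespace false

namespace Summit.PneNP.PneNP.Cruxes.SliceTarget.Ideator3Line

open Literature.Computability.Complexity Finset Filter Classical
open scoped Topology
open Summit.PneNP.PneNP.Theorems.ConstantBand.Negative (Edge thr Central slice errSet)
open Summit.PneNP.PneNP.Theorems.SingleThreshold.Negative (inputList eval_congr length_inputList_le arity_le_two_of_isOver)
open Summit.PneNP.PneNP.Theorems.SliceACZero.Negative (sliceCard sliceCard_eq)

noncomputable section

/-- **The quarter floor**, every `k ≥ 3` (`λ = 1/k! ≤ 1/6`): eventually in `n`, on every central slice `j`, every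
`{∧₂,∨₂}`-circuit erring against `CLIQUE_k` on at most `(λ/8)·#slice_j` graphs has `C(n,2) ≤ 4·size + 1`. Otherwise its read
set `F` (`|F| ≤ 2·size + 1`) has `2|F| ≤ C(n,2)`, the circuit is constant on every fibre of `F`, and replica decoupling (B1) with
the clique density from below (B2) and the pair bound (B3) at `ε = λ/32` gives error `≥ (λ/2 − (3/2)λ² − λ/16)·#slice >
(λ/8)·#slice` since `λ < 5/24`. [folklore] -/
theorem bigBlindFloor : ∀ {k : ℕ}, 3 ≤ k →
    ∀ᶠ n : ℕ in atTop, ∀ j : ℕ, Central k n j → ∀ C : Circuit (Edge n), C.IsOver monotoneBasis →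
      (#(errSet n k j C) : ℝ) ≤ 1 / (k.factorial : ℝ) / 8 * #(slice n j) → n.choose 2 ≤ 4 * C.size + 1 := by
  intro k hk3
  set lam : ℝ := 1 / (k.factorial : ℝ) with hlam
  have hlam0 : 0 < lam := by positivity
  have hlam6 : lam ≤ 1 / 6 := by
    have h : (Nat.factorial 3 : ℝ) ≤ k.factorial := by exact_mod_cast Nat.factorial_le hk3
    have h3 : (Nat.factorial 3 : ℝ) = 6 := by norm_num [Nat.factorial]
    rw [hlam]
    exact one_div_le_one_div_of_le (by norm_num) (by linarith)
  set ε : ℝ := lam / 32 with hε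
  have hε0 : 0 < ε := by positivity
  filter_upwards [stub_cliqueDensityLower k hk3 ε hε0, stub_pairBound k hk3 ε hε0, window_general hk3,
    eventually_ge_atTop 8] with n h2 h3 hW hn8
  intro j hj C hC herr
  obtain ⟨_, hjN, _, _, hN⟩ := hW j hj
  by_contra hsmall
  push Not at hsmall
  -- the read set is at most half of the slots
  set F : Finset (Edge n) := (inputList C).toFinset with hFdef
  have hFmem : ∀ i ∈ inputList C, i ∈ F := fun i hi => List.mem_toFinset.2 hi
  have hF2 : 2 * #F ≤ n.choose 2 := by
    have h1 : #F ≤ (inputList C).length := List.toFinset_card_le _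
    have h2' := length_inputList_le C (arity_le_two_of_isOver hC)
    omega
  have hf : ∀ x y : Edge n → Bool, (∀ e ∈ F, x e = y e) → C.eval x = C.eval y :=
    fun x y hxy => eval_congr C fun i hi => hxy i (hFmem i hi)
  -- replica decoupling with `g = CLIQUE_k`
  have hrep := replica_decoupling n j F (fun x => C.eval x) (cliqueFn n k) hf
  have h2' := h2 j hj
  have h3' := h3 j hj F hF2
  have hS0 : (0 : ℝ) ≤ #(slice n j) := Nat.cast_nonneg _
  have hSpos : (0 : ℝ) < #(slice n j) := by
    have : #(slice n j) = (n.choose 2).choose j := sliceCard_eq n j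
    rw [this]
    exact_mod_cast Nat.choose_pos hjN
  -- `|F|/N ≤ 1/2 + …`: we use `2|F| ≤ N` as `|F|/N ≤ 1/2`
  have hNr : (0 : ℝ) < (n.choose 2 : ℕ) := by exact_mod_cast hN
  have hFN : (#F : ℝ) / (n.choose 2 : ℕ) ≤ 1 / 2 := by
    rw [div_le_iff₀ hNr]
    have : (2 * #F : ℝ) ≤ (n.choose 2 : ℕ) := by exact_mod_cast hF2
    linarith
  -- the error set of `C` on the slice is `{C ≠ CLIQUE}`
  have herr' : (#((slice n j).filter fun x => (fun x => C.eval x) x ≠ cliqueFn n k x) : ℝ) = #(errSet n k j C) := by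
    congr 2
    ext x
    simp only [mem_filter, errSet, Summit.PneNP.PneNP.Theorems.ConstantBand.Negative.slice, mem_univ, true_and]
  rw [herr'] at hrep
  -- combine
  have hpair : ∑ ρ ∈ (slice n j).image (fun x e => if e ∈ F then x e else false),
      (#((slice n j).filter fun x => (∀ e ∈ F, x e = ρ e) ∧ cliqueFn n k x = true) : ℝ) ^ 2 /
        #((slice n j).filter fun x => ∀ e ∈ F, x e = ρ e) ≤ (lam ^ 2 + lam * (1 / 2) + ε) * #(slice n j) := by
    refine h3'.trans (mul_le_mul_of_nonneg_right ?_ hS0)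
    have : lam * ((#F : ℝ) / (n.choose 2 : ℕ)) ≤ lam * (1 / 2) := mul_le_mul_of_nonneg_left hFN hlam0.le
    linarith
  have hmain : (lam - lam ^ 2 / 2 - ε) * #(slice n j) - (lam ^ 2 + lam * (1 / 2) + ε) * #(slice n j) ≤
      lam / 8 * #(slice n j) := by linarith
  have hcoef : lam / 8 < (lam - lam ^ 2 / 2 - ε) - (lam ^ 2 + lam * (1 / 2) + ε) := by
    rw [hε]; nlinarith
  nlinarith

/-- **The window reduction for `c ≥ 2`**: if, for every `c ≥ 2`, some `k ≥ 3` and `δ > 0` make every `{∧₂,∨₂}`-circuit IN THE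
WINDOW `C(n,2) ≤ 4·size + 1` that is `δ`-accurate for `CLIQUE_k` on a central slice have more than `n^c` gates (eventually, every
central `j`), then the same holds for ALL `{∧₂,∨₂}`-circuits, i.e. X(c) for every `c ≥ 2`: with `δ_X = min δ (λ/8)` a
`δ_X`-accurate circuit is in the window by `bigBlindFloor`. [folklore] -/
theorem sliceTargetFrom2_of_quarter :
    (∀ c : ℕ, 2 ≤ c → ∃ k : ℕ, 3 ≤ k ∧ ∃ δ : ℝ, 0 < δ ∧
      ∀ᶠ n : ℕ in atTop, ∀ j : ℕ, Central k n j → ∀ C : Circuit (Edge n), C.IsOver monotoneBasis →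
        n.choose 2 ≤ 4 * C.size + 1 → (#(errSet n k j C) : ℝ) ≤ δ * #(slice n j) → n ^ c < C.size) →
    ∀ c : ℕ, 2 ≤ c → ∃ k : ℕ, 3 ≤ k ∧ ∃ δ : ℝ, 0 < δ ∧
      ∀ᶠ n : ℕ in atTop, ∀ j : ℕ, Central k n j → ∀ C : Circuit (Edge n), C.IsOver monotoneBasis →
        (#(errSet n k j C) : ℝ) ≤ δ * #(slice n j) → n ^ c < C.size := by
  intro h9 c hc
  obtain ⟨k, hk, δ, hδ, hP⟩ := h9 c hc
  set δX : ℝ := min δ (1 / (k.factorial : ℝ) / 8) with hδX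
  have hδX0 : 0 < δX := lt_min hδ (by positivity)
  refine ⟨k, hk, δX, hδX0, ?_⟩
  filter_upwards [hP, bigBlindFloor hk] with n hPn hfl j hj C hC herr
  have hS0 : (0 : ℝ) ≤ #(slice n j) := Nat.cast_nonneg _
  have herr8 : (#(errSet n k j C) : ℝ) ≤ 1 / (k.factorial : ℝ) / 8 * #(slice n j) :=
    herr.trans (mul_le_mul_of_nonneg_right (min_le_right _ _) hS0)
  have herrδ : (#(errSet n k j C) : ℝ) ≤ δ * #(slice n j) :=
    herr.trans (mul_le_mul_of_nonneg_right (min_le_left _ _) hS0)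
  exact hPn j hj C hC (hfl j hj C hC herr8) herrδ

/-- Conversely (trivially) X(c) for `c ≥ 2` gives its windowed restriction. [folklore] -/
theorem quarter_of_sliceTargetFrom2
    (h : ∀ c : ℕ, 2 ≤ c → ∃ k : ℕ, 3 ≤ k ∧ ∃ δ : ℝ, 0 < δ ∧
      ∀ᶠ n : ℕ in atTop, ∀ j : ℕ, Central k n j → ∀ C : Circuit (Edge n), C.IsOver monotoneBasis →
        (#(errSet n k j C) : ℝ) ≤ δ * #(slice n j) → n ^ c < C.size) :
    ∀ c : ℕ, 2 ≤ c → ∃ k : ℕ, 3 ≤ k ∧ ∃ δ : ℝ, 0 < δ ∧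
      ∀ᶠ n : ℕ in atTop, ∀ j : ℕ, Central k n j → ∀ C : Circuit (Edge n), C.IsOver monotoneBasis →
        n.choose 2 ≤ 4 * C.size + 1 → (#(errSet n k j C) : ℝ) ≤ δ * #(slice n j) → n ^ c < C.size := by
  intro c hc
  obtain ⟨k, hk, δ, hδ, H⟩ := h c hc
  refine ⟨k, hk, δ, hδ, ?_⟩
  filter_upwards [H] with n hn j hj C hC _ herr
  exact hn j hj C hC herr

/-- **The crux above exponent `1` IS its windowed form**: X(c) for all `c ≥ 2` ⟺ the same restricted to `{∧₂,∨₂}`-circuits with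
`C(n,2) ≤ 4·size + 1` (the registered stub T9 `stub_sliceHardQuarter` of line `Sketch-ideator3-r1`). [folklore] -/
theorem quarter_iff_sliceTargetFrom2 :
    (∀ c : ℕ, 2 ≤ c → ∃ k : ℕ, 3 ≤ k ∧ ∃ δ : ℝ, 0 < δ ∧
      ∀ᶠ n : ℕ in atTop, ∀ j : ℕ, Central k n j → ∀ C : Circuit (Edge n), C.IsOver monotoneBasis →
        n.choose 2 ≤ 4 * C.size + 1 → (#(errSet n k j C) : ℝ) ≤ δ * #(slice n j) → n ^ c < C.size) ↔
    (∀ c : ℕ, 2 ≤ c → ∃ k : ℕ, 3 ≤ k ∧ ∃ δ : ℝ, 0 < δ ∧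
      ∀ᶠ n : ℕ in atTop, ∀ j : ℕ, Central k n j → ∀ C : Circuit (Edge n), C.IsOver monotoneBasis →
        (#(errSet n k j C) : ℝ) ≤ δ * #(slice n j) → n ^ c < C.size) :=
  ⟨sliceTargetFrom2_of_quarter, quarter_of_sliceTargetFrom2⟩

end

end Summit.PneNP.PneNP.Cruxes.SliceTarget.Ideator3Line
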